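import Summits.Ventures.PercRepro.RankLevelSetLevelNineArithPartThreeZA
import Summits.Ventures.PercRepro.RankLevelSetLevelNineArithPartThreeZB

/-!
# PercRepro — THE LEVEL-`9` DISPATCHER OF THE PARTITION CHAIN WITH THE THREE-MULTIPLICITY: `(P_d)` for `10 ≤ d ≤ 361`, `p ≥ 738`
(p4, gen 15; a feeder for S4). The 352 cases of RankLevelSetLevelNineArithPartThreeAA … BR through the two halves ZA / ZB.
Axioms: standard.
-/

namespace PercRepro

namespace ThmN

/-- **`(P_d)` at level `9` in the `7/8` form with the three-multiplicity (partition count), every corank `10 ≤ d ≤ 361`,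
every `p ≥ 738`, in `ℚ`** — the dispatcher of the 352 cases. -/
theorem level_nine_poly_part3 (d : ℕ) (hd1 : 10 ≤ d) (hd2 : d ≤ 361) (p : ℕ) (hp : 738 ≤ p) :
    8 * ((((p + d).choose 9 : ℕ) : ℚ) + (∑ j ∈ Finset.range (d - 9), ((Nat.choose (min 309 (max ((d + min 151 d) / 2 + 1) (min 150 (d - 1) + 2) - 2)) j : ℕ) : ℚ) / (((j + 1) + 3 * (j + 1).choose 2 : ℕ) : ℚ)) *
      (((d * (d + 1) / 2 : ℕ) : ℚ) * ((p + d).choose 7 : ℚ) + ((d * (d + 1) * (d + 2) / 3 : ℕ) : ℚ) * ((p + d).choose 6 : ℚ) + (((d + 4).choose 5 : ℕ) : ℚ) * ((p + d).choose 5 : ℚ) + (((d + 5).choose 6 : ℕ) : ℚ) * ((p + d).choose 4 : ℚ) + (((d + 6).choose 7 : ℕ) : ℚ) * ((p + d).choose 3 : ℚ) + (((d + 7).choose 8 : ℕ) : ℚ) * ((p + d).choose 2 : ℚ) + (((d + 8).choose 9 : ℕ) : ℚ) * (p + d : ℚ) + (((d + 9).choose 10 : ℕ) : ℚ)) +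
      ((∑ j ∈ Finset.range (d - 9), ((Nat.choose (min 319 (9 + d) - 10) j : ℕ) : ℚ) / (((j + 1) + 3 * (j + 1).choose 2 : ℕ) : ℚ)) - (∑ j ∈ Finset.range (d - 9), ((Nat.choose (min 150 (d - 1)) j : ℕ) : ℚ) / (((j + 1) + 3 * (j + 1).choose 2 : ℕ) : ℚ))) *
      ((d * (d + 1) / 2 * (min 319 (9 + d)).choose 7 + d * (d + 1) * (d + 2) / 3 * (min 319 (9 + d)).choose 6 + (d + 4).choose 5 * (min 319 (9 + d)).choose 5 + (d + 5).choose 6 * (min 319 (9 + d)).choose 4 + (d + 6).choose 7 * (min 319 (9 + d)).choose 3 + (d + 7).choose 8 * (min 319 (9 + d)).choose 2 + (d + 8).choose 9 * (min 319 (9 + d)) + (d + 9).choose 10 : ℕ) : ℚ)) ≤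
      7 * 2 ^ (d - 9) * (((p + 9).choose 9 : ℕ) : ℚ) := by
  rcases Nat.lt_or_ge d (185 + 1) with h | h
  · exact level_nine_poly_part3_ZA d hd1 (by omega) p hp
  · exact level_nine_poly_part3_ZB d (by omega) hd2 p hp

end ThmN

end PercRepro
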